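import Literature.NumberTheory.EllipticCurves.IwasawaTowerTorsionFiniteProofs
import Literature.NumberTheory.EllipticCurves.TwoVariableAnticyclotomicControl
import Literature.NumberTheory.EllipticCurves.ZpExtensionDecompositionOpenImageProofs
import Literature.NumberTheory.EllipticCurves.TateModuleBaseChange
import Literature.NumberTheory.EllipticCurves.PrimaryTorsionFrobeniusUnramifiedProofs
import Literature.NumberTheory.QuadraticFields.UnitsModCubes
import Mathlib.NumberTheory.Cyclotomic.CyclotomicCharacter
import Mathlib.RingTheory.RootsOfUnity.AlgebraicallyClosed
import Mathlib.FieldTheory.Galois.Infinite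
import HarnessLib

/-!
# `E_K[p^∞]^{Gal(K̄/K̃_∞)}` is FINITE over the `ℤ_p²`-tower of an imaginary quadratic field: the fixed-point input (TPfe) of crux 4's
# `stub_acDescent` (stmt-BirchSwinnertonDyer-19034, line «crystal» v10), DISCHARGED for every `E/ℚ`, `p` odd, `K` with `d_K < −4`
# (cell `bsd-eis`, width seat `bsd-line-x2-p2` gen 14; `--supports stmt-BirchSwinnertonDyer-19034`; skeleton of record UNCHANGED, W-79)

WHY. `AcDescent.acDescent_of_inputs_fe` (this seat, p702662) reads `stub_acDescent ⟸ (FE) ∧ (TPfe)` with (TPfe) = «for every cell-C datum and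
cyclotomic/anticyclotomic generator pair, `∃ a, p^a · E_K[p^∞]^{pairKer κ₁ κ} = 0`». This file PROVES (TPfe) — so that `stub_acDescent ⟸ (FE)`
alone (`…AcDescentOfFiniteExponent`, next file).

THE PROOF (new formal proof; Greenberg LNM 1716 §1 p. 62 cites Mazur / Imai / Ribet for «`E(F_∞)_{tors}` is finite»):
* §1 over `ℚ`, for ANY normal subgroup `N ⊴ Γ_ℚ`: if `B = E[p^∞]^N` is infinite, its stable image `p^{j₀}B` is a non-zero `p`-divisible
  `Γ_ℚ`-STABLE subgroup (normality), so contains every `E[p^k]` by the tree's `geomTorsion_pow_le_of_stable_divisible` (no `Γ_ℚ`-stable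
  `p`-divisible line: Shafarevich + `End_ℚ(E) = ℤ`, `GaloisStableDivisibleSubgroupProofs`) — VERBATIM the tree's
  `smul_eq_self_of_mem_geomTorsion_of_infinite` with `ker κ` replaced by `N` (`smul_eq_self_of_mem_geomTorsion_of_infinite_of_normal`); hence
  `N` fixes `E[p]`, and by the Weil pairing `e_p` (`exists_weilPairing_holds`: non-degenerate, `Γ_ℚ`-equivariant) `N` fixes a `p`-th root of unity
  `ζ ≠ 1` — so **`finite_fixedPoints_geomPrimaryTorsion_of_normal`: if some `τ ∈ N` moves every `ζ ≠ 1` with `ζ^p = 1`, `E[p^∞]^N` is finite**.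
* §2 `N = res(pairKer κ₁ κ) ≤ Γ_ℚ` (`res = absGaloisRestrict ℚ K`) for `K` imaginary quadratic, `κ₁` cyclotomic, `κ` anticyclotomic IS NORMAL in `Γ_ℚ`
  (`res(Γ_K)` has index two; a lift of complex conjugation fixes `κ₁` — `IsCyclotomic.apply_eq_of_absGaloisRestrict_eq_conj` — and inverts `κ`), and
  MOVES `μ_p ∖ {1}` when `p` is odd and `d_K < −4`: if `N` fixed a primitive `ζ`, the mod-`p` cyclotomic character of `Γ_K` (Mathlib
  `modularCyclotomicCharacter` on `ℚ̄`, read through `res`) would kill `pairKer`, so have `p`-group image (`isPGroup_range_of_pairKer_le`) inside a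
  group of order prime to `p`, i.e. be trivial; then `ζ`, moved to `K̄` by `absClosureEmbedding`, is `Γ_K`-fixed, hence in `K` (infinite Galois
  descent, `InfiniteGalois.fixedField_fixingSubgroup ⊥`), hence a unit of `𝓞_K`, hence `= ±1` (`QuadraticFields.units_eq_one_or_neg_one`, `d_K < −4`),
  contradicting `ζ^p = 1 ≠ ζ`, `p` odd.
* §3 transfer `E[p^∞](ℚ̄) → E_K[p^∞](K̄)` along `θ = geomPointsMapOfEmb (absClosureEmbedding ℚ K)` (bijective on `p`-power torsion, equivariant
  along `res`: `geomPointsMapOfEmb_smul` + `resGalOfEmb_absClosureEmbedding`): `E_K[p^∞]^{pairKer} = θ(E[p^∞]^N)` is finite, so of finite exponent —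
  **`WeierstrassCurve.exists_pow_smul_eq_zero_of_fixed_pairKer`**, the (TPfe) input VERBATIM.

HONEST FRAMING: theorems only (0 defs, 0 named facts, 0 sorry); nothing about Selmer groups or `L`-functions; no summit statement / BSD / MC / IMC is
proved; 0 cells / labels / tiers move.

References: [GreenbergLNM1716] §1 p. 62, §3 Lemma 3.1, §4 Prop. 4.8; [SilvermanAEC2009] Prop. III.8.1, Cor. IX.6.2; [Washington1997] §13.1; Mazur 1972
Prop. 6.12, Imai 1975, Ribet 1981 (printed finiteness theorems; none followed); tree `IwasawaTowerTorsionFiniteProofs`, `GaloisStableDivisibleSubgroupProofs`.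
-/

set_option autoImplicit false
set_option linter.dupNamespace false

noncomputable section

open scoped Classical AddSubgroup

universe u

/-! ## §1 Over `ℚ`: fixed points of a NORMAL subgroup of `Γ_ℚ` on `E[p^∞]` -/

namespace WeierstrassCurve

open Literature.NumberTheory.EllipticCurves Literature.NumberTheory.GaloisRepresentations

variable (W : WeierstrassCurve ℚ) [W.IsElliptic] {p : ℕ} [Fact p.Prime] (N : Subgroup (Field.absoluteGaloisGroup ℚ))

omit [W.IsElliptic] [Fact p.Prime] in
/-- `E[p^∞]^N` is `Γ_ℚ`-stable for a NORMAL subgroup `N ≤ Γ_ℚ` (the case `N = ker κ` is the tree's `smul_mem_fixedPoints_kerSubgroup`).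
[cite: GreenbergLNM1716, §3 Lemma 3.1 (PDF p. 86)] -/
theorem smul_mem_fixedPoints_geomPrimaryTorsion_of_normal [hN : N.Normal] (σ : Field.absoluteGaloisGroup ℚ)
    {m : geomPrimaryTorsion W p} (hm : m ∈ FixedPoints.addSubgroup N (geomPrimaryTorsion W p)) :
    σ • m ∈ FixedPoints.addSubgroup N (geomPrimaryTorsion W p) := by
  rw [FixedPoints.mem_addSubgroup] at hm ⊢
  rintro ⟨τ, hτ⟩
  have hconj : σ⁻¹ * τ * σ ∈ N := by
    simpa only [inv_inv, mul_assoc] using hN.conj_mem τ hτ σ⁻¹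
  have h := hm ⟨σ⁻¹ * τ * σ, hconj⟩
  rw [Subgroup.mk_smul] at h ⊢
  calc τ • σ • m = σ • ((σ⁻¹ * τ * σ) • m) := by
        rw [mul_smul, mul_smul, smul_inv_smul]
    _ = σ • m := by rw [h]

/-- **If `E[p^∞]^N` is infinite for a normal `N ⊴ Γ_ℚ` then `N` fixes every `E[p^k]` pointwise** — VERBATIM the tree's
`smul_eq_self_of_mem_geomTorsion_of_infinite` (the case `N = ker κ`): the stable image `p^{j₀}B` of `B = E[p^∞]^N` is an infinite `p`-divisible
`Γ_ℚ`-stable subgroup of `E[p^∞]`, hence contains every `E[p^k]` (`geomTorsion_pow_le_of_stable_divisible`: no `Γ_ℚ`-stable `p`-divisible line, by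
Shafarevich + `End_ℚ(E) = ℤ`). [cite: GreenbergLNM1716, §3 p. 86 (Lemma 3.1)] [cite: SilvermanAEC2009, Cor. IX.6.2] -/
theorem smul_eq_self_of_mem_geomTorsion_of_infinite_of_normal [N.Normal]
    (hinf : ¬ Finite (FixedPoints.addSubgroup N (geomPrimaryTorsion W p)))
    (k : ℕ) {τ : Field.absoluteGaloisGroup ℚ} (hτ : τ ∈ N) {T : W.geomPoints}
    (hT : T ∈ geomTorsion W ((p ^ k : ℕ) : ℤ)) : τ • T = T := by
  have hp : p.Prime := Fact.out
  set M : AddSubgroup W.geomPoints := geomPrimaryTorsion W p with hM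
  set B : AddSubgroup M := FixedPoints.addSubgroup N M with hB
  -- `B` is `p`-primary with finite `p`-torsion
  have hprimB : ∀ b : B, ∃ k : ℕ, p ^ k • b = 0 := fun b ↦ by
    obtain ⟨k, hk⟩ := (b : M).2
    refine ⟨k, Subtype.ext (Subtype.ext ?_)⟩
    simp only [AddSubmonoidClass.coe_nsmul, ZeroMemClass.coe_zero]
    exact hk
  haveI : Finite (geomTorsion W (p : ℤ)) := finite_geomTorsion_natCast W hp.ne_zero
  haveI : Finite ((B)[(p : ℕ)]) := by
    refine Finite.of_injective (fun x : (B)[(p : ℕ)] ↦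
      (⟨(((x : B) : M) : W.geomPoints), ?_⟩ : geomTorsion W (p : ℤ))) ?_
    · refine AddSubgroup.torsionBy.nsmul_iff.mpr ?_
      have h := congrArg (fun b : B ↦ ((b : M) : W.geomPoints))
        (AddSubgroup.torsionBy.nsmul_iff.mp x.2)
      simpa only [AddSubmonoidClass.coe_nsmul, ZeroMemClass.coe_zero] using h
    · intro x y hxy
      have h := congrArg Subtype.val hxy
      dsimp only at h
      exact Subtype.ext (Subtype.ext (Subtype.ext h))
  -- the stable image `D₀ = p^{j₀} B = p^{j₀+1} B`
  obtain ⟨j₀, hj₀⟩ := PrimaryGroup.exists_powRange_succ_eq p hprimB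
  obtain ⟨t, ht⟩ := PrimaryGroup.exists_card_quotient_powRange_le p hprimB
  set D₀ : AddSubgroup B := (nsmulAddMonoidHom (p ^ j₀) : B →+ B).range with hD₀
  have hD₀inf : ¬ Finite D₀ := by
    intro hfin
    apply hinf
    haveI := (ht j₀).1
    refine Nat.finite_of_card_ne_zero ?_
    rw [← AddSubgroup.card_mul_index D₀, AddSubgroup.index_eq_card]
    exact mul_ne_zero Nat.card_pos.ne' Nat.card_pos.ne'
  have hdiv₀ : ∀ x ∈ D₀, ∃ y ∈ D₀, p • y = x := by
    rintro x hx
    have hx' : x ∈ (nsmulAddMonoidHom (p ^ (j₀ + 1)) : B →+ B).range := by rw [hj₀]; exact hx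
    obtain ⟨c, rfl⟩ := hx'
    refine ⟨p ^ j₀ • c, ⟨c, rfl⟩, ?_⟩
    change p • p ^ j₀ • c = p ^ (j₀ + 1) • c
    rw [pow_succ', mul_smul]
  -- transport to `E(ℚ̄)` along `B ≤ M ≤ E(ℚ̄)`
  set e : B →+ W.geomPoints := M.subtype.comp B.subtype with he_def
  have he : ∀ b : B, e b = ((b : M) : W.geomPoints) := fun _ ↦ rfl
  have he_inj : Function.Injective e := fun a b h ↦ Subtype.ext (Subtype.ext h)
  set D : AddSubgroup W.geomPoints := D₀.map e with hD
  have hprim : ∀ P ∈ D, ∃ k : ℕ, p ^ k • P = 0 := by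
    rintro _ ⟨b, -, rfl⟩
    obtain ⟨k, hk⟩ := hprimB b
    exact ⟨k, by rw [← map_nsmul, hk, map_zero]⟩
  have hdiv : ∀ P ∈ D, ∃ Q ∈ D, p • Q = P := by
    rintro _ ⟨b, hb, rfl⟩
    obtain ⟨c, hc, hcb⟩ := hdiv₀ b hb
    exact ⟨e c, ⟨c, hc, rfl⟩, by rw [← map_nsmul, hcb]⟩
  have hstab : ∀ (σ : Field.absoluteGaloisGroup ℚ) (P : W.geomPoints), P ∈ D → σ • P ∈ D := by
    rintro σ _ ⟨b, ⟨c, rfl⟩, rfl⟩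
    set c' : B := ⟨σ • (c : M), W.smul_mem_fixedPoints_geomPrimaryTorsion_of_normal N σ c.2⟩ with hc'
    refine ⟨p ^ j₀ • c', ⟨c', rfl⟩, ?_⟩
    rw [map_nsmul, nsmulAddMonoidHom_apply, map_nsmul, smul_comm σ (p ^ j₀) (e c)]
    rfl
  have hne : D ≠ ⊥ := by
    intro hDbot
    apply hD₀inf
    haveI : Subsingleton D₀ := by
      refine ⟨fun x y ↦ Subtype.ext (he_inj ?_)⟩
      have hx : e (x : B) ∈ D := ⟨x, x.2, rfl⟩
      have hy : e (y : B) ∈ D := ⟨y, y.2, rfl⟩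
      rw [hDbot, AddSubgroup.mem_bot] at hx hy
      rw [hx, hy]
    infer_instance
  -- `E[p^k] ≤ D ≤ B`
  have hle : geomTorsion W ((p ^ k : ℕ) : ℤ) ≤ D :=
    W.geomTorsion_pow_le_of_stable_divisible hprim hdiv hstab hne k
  obtain ⟨b, -, hb⟩ := hle hT
  have hfix := (FixedPoints.mem_addSubgroup _ _ _).mp b.2 ⟨τ, hτ⟩
  rw [Subgroup.mk_smul] at hfix
  rw [← hb, he, ← primaryComponent.coe_smul, hfix]

/-- **`E[p^∞]^N` is finite as soon as `N ⊴ Γ_ℚ` moves the primitive `p`-th roots of unity.** Otherwise `N` fixes `E[p]` pointwise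
(`smul_eq_self_of_mem_geomTorsion_of_infinite_of_normal`); take `T ∈ E[p] ∖ 0` (`#E[p] = p²`) and, by non-degeneracy of the Weil pairing `e_p`
(`exists_weilPairing_holds`), `S` with `ζ = e_p(S, T) ≠ 1`; then `ζ^p = 1` and `τ · ζ = e_p(τS, τT) = ζ` for every `τ ∈ N` (equivariance),
contradicting the hypothesis. [cite: SilvermanAEC2009, Prop. III.8.1] [cite: GreenbergLNM1716, §3 p. 86] -/
theorem finite_fixedPoints_geomPrimaryTorsion_of_normal [N.Normal]
    (hN : ∀ ζ : AlgebraicClosure ℚ, ζ ^ p = 1 → ζ ≠ 1 → ∃ τ ∈ N, τ • ζ ≠ ζ) :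
    Finite (FixedPoints.addSubgroup N (geomPrimaryTorsion W p)) := by
  have hp : p.Prime := Fact.out
  by_contra hinf
  have hfix : ∀ {τ : Field.absoluteGaloisGroup ℚ}, τ ∈ N → ∀ T : geomTorsion W ((p ^ 1 : ℕ) : ℤ), τ • T = T :=
    fun hτ T ↦ Subtype.ext (by
      rw [AddSubgroup.torsionBy.coe_smul]
      exact W.smul_eq_self_of_mem_geomTorsion_of_infinite_of_normal N hinf 1 hτ T.2)
  -- the Weil pairing on `E[p]`
  have hpQ : ((p ^ 1 : ℕ) : ℚ) ≠ 0 := by exact_mod_cast pow_ne_zero 1 hp.ne_zero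
  have hp2 : 2 ≤ p ^ 1 := by rw [pow_one]; exact hp.two_le
  obtain ⟨w, hpow, haddl, haddr, halt, hnd, hgal⟩ := exists_weilPairing_holds W (p ^ 1) hp2 hpQ
  -- a non-zero `T ∈ E[p]`
  obtain ⟨T, hT⟩ : ∃ T : geomTorsion W ((p ^ 1 : ℕ) : ℤ), T ≠ 0 := by
    by_contra h
    push Not at h
    haveI : Subsingleton (geomTorsion W ((p ^ 1 : ℕ) : ℤ)) := ⟨fun a b ↦ by rw [h a, h b]⟩
    have hcard := natCard_geomTorsion_eq_sq W hpQ
    rw [Nat.card_of_subsingleton (0 : geomTorsion W ((p ^ 1 : ℕ) : ℤ)), pow_one] at hcard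
    have : 1 < p ^ 2 := Nat.one_lt_pow two_ne_zero hp.one_lt
    omega
  -- `S` with `ζ = e(S, T) ≠ 1`
  obtain ⟨S, hS⟩ : ∃ S, w S T ≠ 1 := by
    by_contra h
    push Not at h
    exact hT (hnd _ h)
  obtain ⟨τ, hτ, hτζ⟩ := hN (w S T) (by rw [← pow_one p]; exact hpow S T) hS
  exact hτζ (by rw [hgal, hfix hτ S, hfix hτ T])

end WeierstrassCurve


/-! ## §2 The subgroup `N = res(Gal(K̄/K̃_∞)) ≤ Γ_ℚ` is normal and moves `μ_p ∖ {1}` -/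

namespace Literature.NumberTheory.EllipticCurves.ZpExtension

open NumberField Field Literature.NumberTheory.GaloisRepresentations

variable {K : Type} [Field K] [NumberField K] {p : ℕ} [Fact p.Prime]

/-- **`res(Gal(K̄/K̃_∞))` is normal in `Γ_ℚ`** (`K̃_∞/ℚ` is Galois): for `K` imaginary quadratic, `κ₁` cyclotomic and `κ` anticyclotomic, the image
of `pairKer κ₁ κ` under `res = absGaloisRestrict ℚ K` is a normal subgroup of `Γ_ℚ`. For `g ∈ Γ_ℚ` and `τ ∈ pairKer`, `g (res τ) g⁻¹ = res τ'`
(`res(Γ_K)` has index two, `IndexTwo.conj_mem_range`) with `κ₁ τ' = κ₁ τ = 1` (`IsCyclotomic.apply_eq_of_absGaloisRestrict_eq_conj`) and `κ τ' = (κ τ)^{±1} = 1`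
(`IsAnticyclotomic` for `g ∉ res(Γ_K)`; injectivity of `res` and commutativity of `ℤ_p` for `g ∈ res(Γ_K)`).
[cite: Washington1997, §13.1] [cite: Brink2007, §II Prop. 1 (K^anti is pro-dihedral over ℚ)] -/
theorem normal_map_pairKer (hK : IsImaginaryQuadratic K) {κ₁ κ : ZpExtension K p} (hκ₁ : κ₁.IsCyclotomic)
    (hκ : κ.IsAnticyclotomic) :
    ((pairKer κ₁ κ).map (absGaloisRestrict ℚ K).toMonoidHom).Normal := by
  have hidx := fun ρ₁ ρ₂ (h₁ : ρ₁ ∉ Set.range (absGaloisRestrict ℚ K))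
      (h₂ : ρ₂ ∉ Set.range (absGaloisRestrict ℚ K)) ↦ inv_mul_mem_range_absGaloisRestrict hK.1 h₁ h₂
  refine ⟨?_⟩
  rintro _ ⟨τ, hτ, rfl⟩ g
  obtain ⟨τ', hτ'⟩ := IndexTwo.conj_mem_range (absGaloisRestrict ℚ K) hidx g τ
  change g * absGaloisRestrict ℚ K τ * g⁻¹ ∈ _
  rw [← hτ']
  refine ⟨τ', ?_, rfl⟩
  rw [SetLike.mem_coe, mem_pairKer_iff] at hτ ⊢
  refine ⟨?_, ?_⟩
  · rw [hκ₁.apply_eq_of_absGaloisRestrict_eq_conj hτ', hτ.1]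
  · by_cases hg : g ∈ Set.range (absGaloisRestrict ℚ K)
    · obtain ⟨σ, rfl⟩ := hg
      have e : τ' = σ * τ * σ⁻¹ := absGaloisRestrict_injective ℚ K (by rw [hτ', map_mul, map_mul, map_inv])
      rw [e, map_mul, map_mul, map_inv, hτ.2, mul_one, mul_inv_cancel]
    · rw [hκ τ τ' g hg hτ', hτ.2, inv_one]

/-- **`Gal(K̄/K̃_∞)` moves the primitive `p`-th roots of unity** (`μ_p ⊄ K̃_∞`): for `K` imaginary quadratic with `d_K < −4`, `p` odd, `κ₁` cyclotomic and
`κ` anticyclotomic with a generator pair, every `ζ ∈ ℚ̄` with `ζ^p = 1 ≠ ζ` is moved by some element of `res(pairKer κ₁ κ)`. Otherwise the mod-`p` cyclotomic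
character of `Γ_K` at `ζ` (Mathlib `IsPrimitiveRoot.autToPow`, through `res`) kills `pairKer`, so its image is a `p`-group
(`isPGroup_range_of_pairKer_le`) in a group of order prime to `p`, hence trivial: all of `Γ_K` fixes `ζ`; moved to `K̄` (`absClosureEmbedding`,
`absGaloisRestrict_apply_smul`) `ζ` is `Γ_K`-fixed, hence in `K` (infinite Galois descent), a unit of `𝓞_K`, so `= ±1`
(`Quadratic.TauData.units_eq_one_or_neg_one`, `d_K < −4`) — impossible for `ζ^p = 1 ≠ ζ` with `p` odd. [cite: Washington1997, §13.1]
[cite: GreenbergLNM1716, §4, proof of Prop. 4.8 (PDF p. 109)] -/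
theorem exists_mem_map_pairKer_smul_ne (hK : IsImaginaryQuadratic K) (hD : NumberField.discr K < -4) (hp2 : p ≠ 2)
    {κ₁ κ : ZpExtension K p} {γ₁ γ : absoluteGaloisGroup K} (hγ : IsTopGeneratorPair κ₁ κ γ₁ γ)
    (ζ : AlgebraicClosure ℚ) (hζp : ζ ^ p = 1) (hζ1 : ζ ≠ 1) :
    ∃ τ ∈ (pairKer κ₁ κ).map (absGaloisRestrict ℚ K).toMonoidHom, τ • ζ ≠ ζ := by
  have hp : p.Prime := Fact.out
  haveI : Fact (1 < p) := ⟨hp.one_lt⟩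
  by_contra H
  push Not at H
  have hfixK : ∀ σ ∈ pairKer κ₁ κ, absGaloisRestrict ℚ K σ • ζ = ζ := fun σ hσ ↦ H _ ⟨σ, hσ, rfl⟩
  -- `ζ` is a primitive `p`-th root of unity
  have hζ : IsPrimitiveRoot ζ p := by
    refine (IsPrimitiveRoot.iff hp.pos).mpr ⟨hζp, fun l hl0 hlp hl ↦ hζ1 ?_⟩
    have hcop : Nat.Coprime p l := Nat.coprime_of_lt_prime (Nat.pos_iff_ne_zero.mp hl0) hlp hp
    have h1 : ζ ^ Nat.gcd l p = 1 := pow_gcd_eq_one.mpr ⟨hl, hζp⟩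
    rwa [Nat.Coprime.gcd_eq_one hcop.symm, pow_one] at h1
  -- the mod-`p` cyclotomic character of `Γ_K` at `ζ`, read through `res`
  let ψ : absoluteGaloisGroup K →* (ZMod p)ˣ := (hζ.autToPow ℚ).comp (absGaloisRestrict ℚ K).toMonoidHom
  have hψspec : ∀ σ : absoluteGaloisGroup K, ζ ^ ((ψ σ : ZMod p).val) = absGaloisRestrict ℚ K σ • ζ := fun σ ↦
    hζ.autToPow_spec ℚ (absGaloisRestrict ℚ K σ)
  have hψ1 : ∀ σ, absGaloisRestrict ℚ K σ • ζ = ζ → ψ σ = 1 := fun σ hσ ↦ by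
    have h := hψspec σ
    rw [hσ] at h
    have h' : ζ ^ ((ψ σ : ZMod p).val) = ζ ^ 1 := by rw [h, pow_one]
    have hval : ((ψ σ : ZMod p)).val = 1 := hζ.pow_inj (ZMod.val_lt _) hp.one_lt h'
    exact Units.ext (ZMod.val_injective p (by rw [hval, Units.val_one, ZMod.val_one]))
  -- the permutation representation on `(ℤ/p)ˣ`: it kills `pairKer`, so its range is a `p`-group inside a group of order `(p-1)!`
  let ρ : absoluteGaloisGroup K →* Equiv.Perm (ZMod p)ˣ := (MulAction.toPermHom (ZMod p)ˣ (ZMod p)ˣ).comp ψ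
  have hρ : pairKer κ₁ κ ≤ ρ.ker := fun σ hσ ↦ by
    rw [MonoidHom.mem_ker]
    show MulAction.toPermHom (ZMod p)ˣ (ZMod p)ˣ (ψ σ) = 1
    rw [hψ1 σ (hfixK σ hσ), map_one]
  have hP := isPGroup_range_of_pairKer_le hγ ρ hρ
  have hcard : Nat.card ρ.range = 1 := by
    rcases hP.card_eq_or_dvd with h | h
    · exact h
    · exfalso
      have hdvd : Nat.card ρ.range ∣ Nat.card (Equiv.Perm (ZMod p)ˣ) := Subgroup.card_subgroup_dvd_card _
      have hperm : Nat.card (Equiv.Perm (ZMod p)ˣ) = (p - 1).factorial := by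
        rw [Nat.card_perm, Nat.card_eq_fintype_card (α := (ZMod p)ˣ), ZMod.card_units_eq_totient, Nat.totient_prime hp]
      rw [hperm] at hdvd
      have hle : p ≤ p - 1 := (Nat.Prime.dvd_factorial hp).mp (h.trans hdvd)
      have := hp.pos
      omega
  have hψtriv : ∀ σ, ψ σ = 1 := fun σ ↦ by
    have hmem : ρ σ ∈ ρ.range := ⟨σ, rfl⟩
    rw [Subgroup.eq_bot_of_card_eq _ hcard, Subgroup.mem_bot] at hmem
    have h1 := congrArg (fun e : Equiv.Perm (ZMod p)ˣ ↦ e 1) hmem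
    simp only [ρ, MonoidHom.coe_comp, Function.comp_apply, MulAction.toPermHom_apply, MulAction.toPerm_apply,
      Equiv.Perm.coe_one, id_eq, smul_eq_mul, mul_one] at h1
    exact h1
  -- so all of `Γ_K` fixes `ζ`
  have hfixall : ∀ σ : absoluteGaloisGroup K, absGaloisRestrict ℚ K σ • ζ = ζ := fun σ ↦ by
    have h := hψspec σ
    rw [hψtriv σ, Units.val_one, ZMod.val_one, pow_one] at h
    exact h.symm
  -- descent to `K`: move `ζ` to `K̄`
  set ζ' : AlgebraicClosure K := absClosureEmbedding ℚ K ζ with hζ'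
  have hfix' : ∀ σ : absoluteGaloisGroup K, σ • ζ' = ζ' := fun σ ↦ by
    rw [hζ', ← absGaloisRestrict_apply_smul, hfixall]
  have hmem : ζ' ∈ (⊥ : IntermediateField K (AlgebraicClosure K)) := by
    rw [← InfiniteGalois.fixedField_fixingSubgroup (⊥ : IntermediateField K (AlgebraicClosure K)),
      IntermediateField.mem_fixedField_iff]
    intro f _
    exact hfix' f
  obtain ⟨x, hx⟩ := IntermediateField.mem_bot.mp hmem
  have hxp : x ^ p = 1 := by
    apply (algebraMap K (AlgebraicClosure K)).injective
    rw [map_pow, hx, hζ', ← map_pow, hζp, map_one, map_one]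
  have hx1 : x ≠ 1 := fun h ↦ hζ1 ((absClosureEmbedding ℚ K).injective (by
    show absClosureEmbedding ℚ K ζ = absClosureEmbedding ℚ K 1
    rw [map_one, ← hζ', ← hx, h, map_one]))
  -- `x` is an integral unit of `𝓞 K`, hence `±1`
  have hxint : IsIntegral ℤ x := IsIntegral.of_pow hp.pos (by rw [hxp]; exact isIntegral_one)
  set y : 𝓞 K := ⟨x, hxint⟩ with hy
  have hyp : y ^ p = 1 := by
    apply Subtype.ext
    rw [hy]
    show x ^ p = 1
    exact hxp
  have hyu : IsUnit y := IsUnit.of_pow_eq_one hyp hp.ne_zero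
  obtain ⟨T⟩ := Literature.NumberTheory.QuadraticFields.Quadratic.nonempty_tauData (K := K) hK.1
  rcases Literature.NumberTheory.QuadraticFields.Quadratic.TauData.units_eq_one_or_neg_one T hK.1 hD hyu.unit with h | h
  · rw [IsUnit.unit_spec] at h
    exact hx1 (by rw [hy] at h; exact congrArg Subtype.val h)
  · rw [IsUnit.unit_spec] at h
    have hxneg : x = -1 := by rw [hy] at h; exact congrArg Subtype.val h
    rw [hxneg, (hp.odd_of_ne_two hp2).neg_one_pow] at hxp
    exact absurd hxp (by norm_num)

end Literature.NumberTheory.EllipticCurves.ZpExtension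


/-! ## §3 Transfer to `E_K = E ×_ℚ K` over `K̄`: the (TPfe) input of `stub_acDescent` -/

namespace WeierstrassCurve

open NumberField Field Literature.NumberTheory.EllipticCurves Literature.NumberTheory.GaloisRepresentations

/-- **(TPfe) — `E_K[p^∞]^{Gal(K̄/K̃_∞)}` has finite exponent.** For an elliptic curve `E/ℚ`, an odd prime `p`, an imaginary quadratic `K` with
`d_K < −4`, `κ₁` cyclotomic and `κ` anticyclotomic `ℤ_p`-extensions of `K` with a generator pair: `∃ a, p^a · m = 0` for every
`m ∈ E_K[p^∞](K̄)` fixed by `pairKer κ₁ κ = Gal(K̄/K̃_∞)`. The points are moved to `E[p^∞](ℚ̄)` along `θ = geomPointsMapOfEmb (absClosureEmbedding ℚ K)`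
(a bijection on `p`-power torsion, `exists_geomPointsMapOfEmb_eq_of_mem_geomTorsion`, equivariant along `res`: `geomPointsMapOfEmb_smul`,
`resGalOfEmb_absClosureEmbedding`), where they are fixed by the NORMAL subgroup `res(pairKer)` (§2), whose fixed module is FINITE (§1 + §2), hence of
finite exponent. This is VERBATIM the hypothesis (TPfe) of `AcDescent.acDescent_of_inputs_fe` at one datum. [cite: GreenbergLNM1716, §1 p. 62 and §3 p. 86]
[cite: SilvermanAEC2009, Prop. III.8.1 and Cor. IX.6.2] -/
theorem exists_pow_smul_eq_zero_of_fixed_pairKer (W : WeierstrassCurve ℚ) [W.IsElliptic] {p : ℕ} [Fact p.Prime] (hp2 : p ≠ 2)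
    {K : Type} [Field K] [NumberField K] (hK : IsImaginaryQuadratic K) (hD : NumberField.discr K < -4)
    {κ₁ κ : ZpExtension K p} (hκ₁ : κ₁.IsCyclotomic) (hκ : κ.IsAnticyclotomic)
    {γ₁ γ : absoluteGaloisGroup K} (hγ : ZpExtension.IsTopGeneratorPair κ₁ κ γ₁ γ) :
    ∃ a : ℕ, ∀ m : geomPrimaryTorsion (W.baseChange K) p,
      (∀ σ ∈ ZpExtension.pairKer κ₁ κ, σ • m = m) → p ^ a • m = 0 := by
  have hp : p.Prime := Fact.out
  set N : Subgroup (absoluteGaloisGroup ℚ) := (ZpExtension.pairKer κ₁ κ).map (absGaloisRestrict ℚ K).toMonoidHom with hN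
  haveI : N.Normal := ZpExtension.normal_map_pairKer hK hκ₁ hκ
  haveI hfin : Finite (FixedPoints.addSubgroup N (geomPrimaryTorsion W p)) :=
    W.finite_fixedPoints_geomPrimaryTorsion_of_normal N fun ζ h1 h2 ↦
      ZpExtension.exists_mem_map_pairKer_smul_ne hK hD hp2 hγ ζ h1 h2
  set B := FixedPoints.addSubgroup N (geomPrimaryTorsion W p) with hB
  haveI : Fintype B := Fintype.ofFinite B
  -- a uniform exponent for the finite `p`-primary group `B`
  have hk : ∀ b : B, ∃ k : ℕ, p ^ k • (((b : geomPrimaryTorsion W p)) : W.geomPoints) = 0 := fun b ↦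
    (b : geomPrimaryTorsion W p).2
  choose k hk using hk
  refine ⟨Finset.univ.sup k, fun m hm ↦ ?_⟩
  -- move `m` to `E(ℚ̄)`
  set ι := absClosureEmbedding ℚ K with hι
  obtain ⟨k₀, hk₀⟩ := m.2
  have hn0 : ((p ^ k₀ : ℕ) : ℤ) ≠ 0 := by exact_mod_cast pow_ne_zero k₀ hp.ne_zero
  have hmtor : ((m : geomPoints (W.baseChange K))) ∈ geomTorsion (W.baseChange K) ((p ^ k₀ : ℕ) : ℤ) := by
    rw [mem_geomTorsion_iff, natCast_zsmul, hk₀]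
  obtain ⟨P, hPtor, hP⟩ := exists_geomPointsMapOfEmb_eq_of_mem_geomTorsion W ι hn0 hmtor
  have hPprim : P ∈ geomPrimaryTorsion W p :=
    ⟨k₀, by rw [← natCast_zsmul]; exact (mem_geomTorsion_iff W _ P).mp hPtor⟩
  -- `P` is fixed by `N = res(pairKer)`
  have hPfix : (⟨P, hPprim⟩ : geomPrimaryTorsion W p) ∈ B := by
    rw [hB, FixedPoints.mem_addSubgroup]
    intro g
    obtain ⟨τ, hτ, hτg⟩ := Subgroup.mem_map.mp g.2
    rw [Subgroup.smul_def]
    apply Subtype.ext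
    rw [primaryComponent.coe_smul, ← hτg]
    change absGaloisRestrict ℚ K τ • P = P
    apply geomPointsMapOfEmb_injective W ι
    rw [← resGalOfEmb_absClosureEmbedding, geomPointsMapOfEmb_smul, hP, ← primaryComponent.coe_smul, hm τ hτ]
  -- the exponent
  set b : B := ⟨⟨P, hPprim⟩, hPfix⟩ with hb
  have hle : k b ≤ Finset.univ.sup k := Finset.le_sup (Finset.mem_univ b)
  have hPa : p ^ Finset.univ.sup k • P = 0 := by
    rw [← Nat.sub_add_cancel hle, pow_add, mul_smul]
    have h := hk b
    rw [hb] at h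
    change p ^ k _ • P = 0 at h
    rw [h, smul_zero]
  apply Subtype.ext
  rw [AddSubmonoidClass.coe_nsmul, ZeroMemClass.coe_zero, ← hP, ← map_nsmul, hPa, map_zero]

end WeierstrassCurve

end
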